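import Summits.KontsevichZagierPeriods.KontsevichZagierPeriods.Theorems.ValuedFieldSpecialisationClassLevelExpansionFibreDimOneFibreSubst

/-!
# Route ValuedFieldSpecialisation — crux `ParametricLifting`: the fibred dilation of the Frullani sector

Stub `frullani_dilation` of the Frullani calibration of the crux `ParametricLifting`
(stmt-KontsevichZagierPeriods-3498). Over the base `G = {0 < s, 2 s < 1}` (`s = z 0`), fibre
variable `t = z 1`, the fibrewise dilation `t ↦ u = 2 t` carries the band `{s ≤ t ≤ 1}` onto the
band `{2 s ≤ u ≤ 2}`, fixes the parameter `s` and has Jacobian `2`; since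
`1/(t (1 + 2 t)) = 1/((2 t) (1 + 2 t)) · 2`, it is a FIBRED change of variables from
`B = ({s ≤ t ≤ 1}, 1/(t (1 + 2 t)))` onto `B' = ({2 s ≤ u ≤ 2}, 1/(u (1 + u)))`, whence
`[B] − [B'] ∈ KZ.fibredRelations`: an instance of `of_sub_of_mem_fibredRelations_fibreSubst`
(fibrewise substitutions along the last coordinate are fibred moves) with `ψ (s, t) = 2 t`.

Sources: M. Kontsevich, D. Zagier, *Periods* (2001), §1.2, rule (2); G. Boros, V. Moll,
*Irresistible Integrals* (2004), §5.6 (Frullani). No new definitions.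
-/

noncomputable section

namespace Summit.KontsevichZagierPeriods.ValuedFieldSpecialisation

open MeasureTheory Set Filter
open scoped Topology
open Literature.NumberTheory.Transcendental Literature.NumberTheory.Transcendental.KZ
open Literature.ModelTheory.ExponentialFields (IsSemialgebraic isSemialgebraic_setOf_eval_pos
  isSemialgebraic_setOf_eval_lt isSemialgebraic_setOf_eval_le)

/-- The base `G = {0 < s, 2 s < 1}` of the Frullani families is `ℚ`-semialgebraic. [folklore] -/
theorem frullani_dilation_isSemialgebraic_base :
    IsSemialgebraic ℚ {y : Fin 1 → ℝ | 0 < y 0 ∧ 2 * y 0 < 1} := by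
  have h1 : IsSemialgebraic ℚ {y : Fin 1 → ℝ | 0 < y 0} := by
    simpa using isSemialgebraic_setOf_eval_pos (k := ℚ) (R := ℝ) (MvPolynomial.X (0 : Fin 1))
  have h2 : IsSemialgebraic ℚ {y : Fin 1 → ℝ | 2 * y 0 < 1} := by
    have h := isSemialgebraic_setOf_eval_lt (k := ℚ) (R := ℝ)
      (MvPolynomial.C 2 * MvPolynomial.X (0 : Fin 1)) 1
    simp only [map_mul, MvPolynomial.aeval_C, MvPolynomial.aeval_X, map_one, eq_ratCast,
      Rat.cast_ofNat] at h
    exact h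
  rw [setOf_and]
  exact h1.inter h2

/-- The derivative of the dilation `ψ (s, t) = 2 t` in the fibre direction is `2`. [folklore] -/
theorem frullani_dilation_fderiv_two_mul (z : Fin (1 + 1) → ℝ) :
    fderiv ℝ (fun w : Fin (1 + 1) → ℝ => 2 * w (Fin.last 1)) z (Pi.single (Fin.last 1) 1) = 2 := by
  rw [((hasFDerivAt_apply (𝕜 := ℝ) (Fin.last 1) z).const_mul (2 : ℝ)).fderiv]
  simp

/-- **The fibred dilation `t ↦ 2t` of the Frullani sector.** For `B = ({s ≤ t ≤ 1}, 1/(t(1+2t)))`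
and `B' = ({2s ≤ u ≤ 2}, 1/(u(1+u)))` over the base `{0 < s, 2s < 1}`, the fibrewise dilation
`(s, t) ↦ (s, 2t)` is a fibred change of variables from `B` onto `B'` (it fixes `s`, has Jacobian
`2`, and `1/(t(1+2t)) = 1/((2t)(1+2t)) · 2`), so `[B] − [B'] ∈ KZ.fibredRelations`.
[Kontsevich–Zagier 2001, §1.2 rule (2)] [folklore] -/
theorem frullani_dilation :
    ∀ (B B' : KZ.IntegralRep (1 + 1)), B.domain = KZlog.band {y : Fin 1 → ℝ | 0 < y 0 ∧ 2 * y 0 < 1} (fun y => y 0) (fun _ => 1) → (B.integrand = fun z => (z 1 * (1 + 2 * z 1))⁻¹) → B'.domain = KZlog.band {y : Fin 1 → ℝ | 0 < y 0 ∧ 2 * y 0 < 1} (fun y => 2 * y 0) (fun _ => 2) → (B'.integrand = fun z => (z 1 * (1 + z 1))⁻¹) → KZ.of B - KZ.of B' ∈ KZ.fibredRelations := by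
  intro B B' hBd hBi hB'd hB'i
  -- the base and the edges of the source band
  have hG : IsSemialgebraic ℚ {y : Fin 1 → ℝ | 0 < y 0 ∧ 2 * y 0 < 1} :=
    frullani_dilation_isSemialgebraic_base
  have ha : IsSemialgebraicFunOn ℚ {y : Fin 1 → ℝ | 0 < y 0 ∧ 2 * y 0 < 1} (fun y => y 0) :=
    (isSemialgebraicFunOn_aeval hG (MvPolynomial.X 0)).congr fun y _ => by simp
  have hb : IsSemialgebraicFunOn ℚ {y : Fin 1 → ℝ | 0 < y 0 ∧ 2 * y 0 < 1} (fun _ => (1 : ℝ)) :=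
    (isSemialgebraicFunOn_aeval hG 1).congr fun y _ => by simp
  have hab : ∀ y ∈ {y : Fin 1 → ℝ | 0 < y 0 ∧ 2 * y 0 < 1}, y 0 ≤ (1 : ℝ) := by
    intro y hy
    have hy' : 0 < y 0 ∧ 2 * y 0 < 1 := hy
    linarith [hy'.1, hy'.2]
  have hBsa : IsSemialgebraic ℚ
      (KZlog.band {y : Fin 1 → ℝ | 0 < y 0 ∧ 2 * y 0 < 1} (fun y => y 0) (fun _ => 1)) :=
    KZlog.isSemialgebraic_band ha hb
  -- the substitution `ψ (s, t) = 2 t`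
  have hψsa : IsSemialgebraicFunOn ℚ
      (KZlog.band {y : Fin 1 → ℝ | 0 < y 0 ∧ 2 * y 0 < 1} (fun y => y 0) (fun _ => 1))
      (fun z : Fin (1 + 1) → ℝ => 2 * z (Fin.last 1)) :=
    (isSemialgebraicFunOn_aeval hBsa (MvPolynomial.C 2 * MvPolynomial.X (Fin.last 1))).congr
      fun z _ => by simp
  have hψd : DifferentiableOn ℝ (fun z : Fin (1 + 1) → ℝ => 2 * z (Fin.last 1)) univ :=
    ((differentiable_apply (𝕜 := ℝ) (Fin.last 1)).const_mul (2 : ℝ)).differentiableOn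
  have hψpos : ∀ z ∈ KZlog.band {y : Fin 1 → ℝ | 0 < y 0 ∧ 2 * y 0 < 1} (fun y => y 0) (fun _ => 1),
      0 < fderiv ℝ (fun w : Fin (1 + 1) → ℝ => 2 * w (Fin.last 1)) z (Pi.single (Fin.last 1) 1) := by
    intro z _
    rw [frullani_dilation_fderiv_two_mul]
    norm_num
  have hψmono : ∀ y ∈ {y : Fin 1 → ℝ | 0 < y 0 ∧ 2 * y 0 < 1},
      StrictMonoOn (fun t : ℝ => 2 * (Fin.snoc y t : Fin (1 + 1) → ℝ) (Fin.last 1)) (Icc (y 0) 1) := by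
    intro y _
    simp only [Fin.snoc_last]
    exact (strictMono_mul_left_of_pos (by norm_num : (0 : ℝ) < 2)).strictMonoOn _
  -- the image band `{2 s ≤ u ≤ 2}`
  have hB'd' : B'.domain = KZlog.band {y : Fin 1 → ℝ | 0 < y 0 ∧ 2 * y 0 < 1}
      (fun y => 2 * (Fin.snoc y (y 0) : Fin (1 + 1) → ℝ) (Fin.last 1))
      (fun y => 2 * (Fin.snoc y (1 : ℝ) : Fin (1 + 1) → ℝ) (Fin.last 1)) := by
    rw [hB'd]
    simp only [Fin.snoc_last, mul_one]
  -- the integrands: `1/(t(1+2t)) = 1/((2t)(1+2t)) · 2` on the band (`t ≥ s > 0`)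
  have hint : ∀ z ∈ B.domain, B.integrand z =
      B'.integrand (Fin.snoc (Fin.init z) (2 * z (Fin.last 1))) *
        fderiv ℝ (fun w : Fin (1 + 1) → ℝ => 2 * w (Fin.last 1)) z (Pi.single (Fin.last 1) 1) := by
    intro z hz
    rw [hBd] at hz
    obtain ⟨hy, hza, -⟩ := KZlog.mem_band.1 hz
    have hy' : 0 < Fin.init z 0 ∧ 2 * Fin.init z 0 < 1 := hy
    have ht : 0 < z (Fin.last 1) := lt_of_lt_of_le hy'.1 hza
    have ht' : z (Fin.last 1) ≠ 0 := ht.ne'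
    have h2t : 1 + 2 * z (Fin.last 1) ≠ 0 := by positivity
    rw [frullani_dilation_fderiv_two_mul, hBi, hB'i]
    show (z (Fin.last 1) * (1 + 2 * z (Fin.last 1)))⁻¹ =
      ((Fin.snoc (Fin.init z) (2 * z (Fin.last 1)) : Fin (1 + 1) → ℝ) (Fin.last 1) *
        (1 + (Fin.snoc (Fin.init z) (2 * z (Fin.last 1)) : Fin (1 + 1) → ℝ) (Fin.last 1)))⁻¹ * 2
    rw [Fin.snoc_last]
    field_simp
  exact of_sub_of_mem_fibredRelations_fibreSubst ha hb hab isOpen_univ (subset_univ _) hψsa hψd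
    hψpos hψmono B B' hBd hB'd' hint

end Summit.KontsevichZagierPeriods.ValuedFieldSpecialisation
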